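import Literature.Probability.Percolation.VerticalSweep
import Literature.Probability.Percolation.TrackExchangeCleanAS
import Literature.Probability.LatticeModels.ProdBernoulliIndependence
import HarnessLib

/-!
# The optimal witness of the record height, and closed edges beside it (GM14 (6.35)–(6.36))

Grimmett–Manolescu, *Bond percolation on isoradial graphs* (PTRF 159 (2014) 273–327 =
arXiv:1204.0505), §6.3, proof of (6.34). To bound from below the probability that the record
height does not decrease, one conditions on the *optimal path* `Γ`: "denote by `Γ = Γ(ω^k_j)` the
`ω^k_j`-open path of `𝒫_j` that is the minimal element of `{γ ∈ 𝒫_j : h(γ) = h^k_j, γ is ω^k_j-open}`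
with respect to the order `<`. […] We have that `{Γ(ω^k_j) = γ} = {γ is ω^k_j-open} ∩ N_γ`, where
`N_γ` is the decreasing event that: (a) there is no `γ' ∈ 𝒫_j` with `h(γ') > h(γ)`, all of whose
edges not belonging to `γ` are `ω^k_j`-open, (b) there is no `γ' < γ` with `h(γ') = h(γ)`, all of
whose edges not belonging to `γ` are `ω^k_j`-open. Note that `N_γ` is independent of the event
`{γ is ω^k_j-open}`. Let `F` be a set of edges disjoint from `γ`, and let `C_F` be the event that
every edge in `F` is closed. […] By the Harris–FKG inequality,
`P(C_F | Γ = γ) = P^k_j(N_γ | C_F) P^k_j(C_F) / P^k_j(N_γ) ≥ P^k_j(C_F) = ∏_{f ∈ F} (1 - p_f)`"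
((6.35)–(6.36); the same computation is GM13, Ann. Probab. 41, proof of Lemma 3.7).

This file carries this out on the strip, for the record height `hRec` and the top witnesses
`TopWit` of `VerticalSweep`. The order `<` of the paper (leftmost path) is replaced by an
arbitrary fixed enumeration of the walks (`Encodable.encode`): the argument only uses that the
order is deterministic.

* `TrackExchange.edgesOf`, `isWalk_iff_edgesOf_subset` — the edges used by a walk;
  `TrackExchange.Shape S y W` — the deterministic part of `TopWit` (`topWit_iff`).
* `TrackExchange.optWit S N ω` — **the optimal witness** `Γ`: the top witness of the record
  height with the least code (`optWit_topWit`, `encode_optWit_le`).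
* `TrackExchange.Nev q S N γ y` — **the event `N_γ`** (together with cleanliness), decreasing
  (`isLowerSet_Nev`), measurable, and determined by the coordinates off `γ`
  (`determinedBy_Nev`); `TrackExchange.Eopt q S N y γ` = `{γ open} ∩ N_γ` for walks of the right
  shape, `∅` otherwise; **`mem_Eopt_iff`**: `ω ∈ Eopt q S N y γ ↔ Clean q ω ∧ hRec S N ω = y ∧
  optWit S N ω = γ` (GM14 (6.35)); the `Eopt … y γ` partition `{Clean ∧ hRec = y}`
  (`iUnion_Eopt`, `disjoint_Eopt`).
* **`le_measure_notMem_inter_Eopt`** (GM14 (6.36) with `F = {e}`): for an edge `e` not used by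
  `γ`, `(1 - p_e) · P(Eopt y γ) ≤ P({e closed} ∩ Eopt y γ)` under the canonical product measure
  (Harris' inequality for the decreasing events `{e closed}`, `N_γ` and the independence of
  `{γ open}` from events determined off `γ`).
* `TrackExchange.measurable_hRec` — the record height is a measurable function of the
  configuration.

## References

* G. R. Grimmett, I. Manolescu, PTRF 159 (2014) 273–327, arXiv:1204.0505, §6.3: the path `Γ`,
  the event `N_γ`, (6.35)–(6.36).
* G. R. Grimmett, I. Manolescu, Ann. Probab. 41 (2013), arXiv:1105.5535, §3.3, proof of Lemma 3.7.
* G. R. Grimmett, *Percolation*, 2nd ed. 1999, Thm. (2.4) (Harris–FKG).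
-/

noncomputable section

namespace Literature.Probability.Percolation

open LatticeModels StarTriangle Real MeasureTheory

namespace TrackExchange

/-! ### The edges of a walk -/

/-- The set of edges used by a walk (consecutive pairs). [folklore] -/
def edgesOf : List SV → Finset (Sym2 SV)
  | [] => ∅
  | [_] => ∅
  | a :: b :: l => insert s(a, b) (edgesOf (b :: l))

/-- A walk is open iff all its edges are open. [folklore] -/
theorem isWalk_iff_edgesOf_subset {ω : Set (Sym2 SV)} : ∀ {W : List SV}, IsWalk ω W ↔ ↑(edgesOf W) ⊆ ω
  | [] => by simp [IsWalk, edgesOf]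
  | [_] => by simp [IsWalk, edgesOf]
  | a :: b :: l => by
    show s(a, b) ∈ ω ∧ IsWalk ω (b :: l) ↔ _
    rw [isWalk_iff_edgesOf_subset, edgesOf, Finset.coe_insert, Set.insert_subset_iff]

/-- Every edge of a walk is a consecutive pair. [folklore] -/
theorem exists_infix_of_mem_edgesOf : ∀ {W : List SV} {e : Sym2 SV}, e ∈ edgesOf W → ∃ a b, [a, b] <:+: W ∧ e = s(a, b)
  | [], _, h => by simp [edgesOf] at h
  | [_], _, h => by simp [edgesOf] at h
  | a :: b :: l, e, h => by
    simp only [edgesOf, Finset.mem_insert] at h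
    rcases h with rfl | h
    · exact ⟨a, b, pair_infix_cons_cons a b l, rfl⟩
    · obtain ⟨c, d, hcd, rfl⟩ := exists_infix_of_mem_edgesOf h
      exact ⟨c, d, List.infix_cons hcd, rfl⟩

/-- Consecutive pairs are edges of the walk. [folklore] -/
theorem mem_edgesOf_of_infix : ∀ {W : List SV} {a b : SV}, [a, b] <:+: W → s(a, b) ∈ edgesOf W
  | [], _, _, h => by have := h.length_le; simp at this
  | [_], _, _, h => by have := h.length_le; simp at this
  | x :: y :: l, a, b, h => by
    rw [edgesOf, Finset.mem_insert]
    rcases List.infix_cons_iff.1 h with h1 | h1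
    · rw [pair_prefix_cons_iff, singleton_prefix_iff] at h1
      obtain ⟨hax, hyb⟩ := h1
      have hb : y = b := by simpa using hyb
      exact Or.inl (by rw [hax, hb])
    · exact Or.inr (mem_edgesOf_of_infix h1)

/-! ### The deterministic shape of a top witness -/

/-- The deterministic part of `TopWit`: labels in `S`, from height `0`, to height `y` at the last
vertex, strictly lower before. [cite: GrimmettManolescu2014Isoradial, §6.3] -/
def Shape (S : Set (ℤ × ℤ)) (y : ℤ) (W : List SV) : Prop :=
  InDom S W ∧ (∃ a : ℤ × ℤ, W.head? = some (some a) ∧ a.2 = 0) ∧ (∃ b : ℤ × ℤ, W.getLast? = some (some b) ∧ b.2 = y) ∧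
    ∀ z ∈ W.dropLast, lht z < y

/-- `TopWit` is "open and of the right shape". [folklore] -/
theorem topWit_iff {S : Set (ℤ × ℤ)} {ω : Set (Sym2 SV)} {y : ℤ} {W : List SV} :
    TopWit S ω y W ↔ IsWalk ω W ∧ Shape S y W :=
  ⟨fun h => ⟨h.walk, h.dom, h.head, h.last, h.below⟩, fun h => ⟨h.1, h.2.1, h.2.2.1, h.2.2.2.1, h.2.2.2.2⟩⟩

/-- A walk of the right shape is nonempty. [folklore] -/
theorem Shape.ne_nil {S : Set (ℤ × ℤ)} {y : ℤ} {W : List SV} (h : Shape S y W) : W ≠ [] := by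
  rintro rfl; obtain ⟨a, ha, -⟩ := h.2.1; simp at ha

/-! ### The optimal witness -/

open Classical in
/-- **The optimal witness `Γ(ω)`**: among the top witnesses of the record height, the one with the
least code (GM14: the minimal `ω`-open path of `𝒫_j` reaching `h^k_j`, for a fixed order); the
empty list if there is none. [cite: GrimmettManolescu2014Isoradial, §6.3] -/
def optWit (S : Set (ℤ × ℤ)) (N : ℕ) (ω : Set (Sym2 SV)) : List SV :=
  if h : ∃ n : ℕ, ∃ W : List SV, Encodable.encode W = n ∧ TopWit S ω (hRec S N ω) W then
    Classical.choose (Nat.find_spec h)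
  else []

/-- **The optimal witness is a top witness of the record height** (when there is one), and has the
least code among them. [cite: GrimmettManolescu2014Isoradial, §6.3] -/
theorem optWit_spec {S : Set (ℤ × ℤ)} {N : ℕ} {ω : Set (Sym2 SV)} (h : ∃ W, TopWit S ω (hRec S N ω) W) :
    TopWit S ω (hRec S N ω) (optWit S N ω) ∧
      ∀ W, TopWit S ω (hRec S N ω) W → Encodable.encode (optWit S N ω) ≤ Encodable.encode W := by
  classical
  have h' : ∃ n : ℕ, ∃ W : List SV, Encodable.encode W = n ∧ TopWit S ω (hRec S N ω) W := by
    obtain ⟨W, hW⟩ := h; exact ⟨_, W, rfl, hW⟩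
  have hdef : optWit S N ω = Classical.choose (Nat.find_spec h') := by
    unfold optWit; rw [dif_pos h']
  obtain ⟨henc, hwit⟩ := Classical.choose_spec (Nat.find_spec h')
  rw [hdef]
  refine ⟨hwit, fun W hW => ?_⟩
  rw [henc]
  exact Nat.find_min' h' ⟨W, rfl, hW⟩

/-- **Characterisation of `Γ(ω) = γ`** for a top witness `γ`: no top witness has a smaller code.
[cite: GrimmettManolescu2014Isoradial, §6.3] -/
theorem optWit_eq_iff {S : Set (ℤ × ℤ)} {N : ℕ} {ω : Set (Sym2 SV)} {γ : List SV} (hγ : TopWit S ω (hRec S N ω) γ) :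
    optWit S N ω = γ ↔ ∀ W, Encodable.encode W < Encodable.encode γ → ¬ TopWit S ω (hRec S N ω) W := by
  obtain ⟨hwit, hmin⟩ := optWit_spec (S := S) (N := N) ⟨γ, hγ⟩
  constructor
  · rintro rfl W hlt hW
    exact absurd (hmin W hW) (not_le.2 hlt)
  · intro h
    have h1 := hmin γ hγ
    rcases h1.lt_or_eq with hlt | heq
    · exact absurd hwit (h _ hlt)
    · exact Encodable.encode_injective heq

/-! ### The event `N_γ` and the decomposition of `{Γ = γ}` -/

/-- **The event `N_γ`** of GM14 (6.35), together with cleanliness: no walk of top-witness shape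
reaching higher than `y` (up to `N`) has all its edges off `γ` open, and no walk of top-witness
shape for `y` with a smaller code has all its edges off `γ` open.
[cite: GrimmettManolescu2014Isoradial, §6.3 (6.35)] -/
def Nev (q : Sym2 SV → unitInterval) (S : Set (ℤ × ℤ)) (N : ℕ) (γ : List SV) (y : ℕ) : Set (Set (Sym2 SV)) :=
  {ω | Clean q ω ∧
    (∀ n : ℕ, y < n → n ≤ N → ∀ W : List SV, Shape S n W → ¬ ((↑(edgesOf W) : Set (Sym2 SV)) \ ↑(edgesOf γ) ⊆ ω)) ∧
    (∀ W : List SV, Encodable.encode W < Encodable.encode γ → Shape S y W →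
      ¬ ((↑(edgesOf W) : Set (Sym2 SV)) \ ↑(edgesOf γ) ⊆ ω))}

open Classical in
/-- **The event `{Γ = γ} = {γ open} ∩ N_γ`**, as a function of `γ` (empty for walks not of
top-witness shape for `y`). [cite: GrimmettManolescu2014Isoradial, §6.3 (6.35)] -/
def Eopt (q : Sym2 SV → unitInterval) (S : Set (ℤ × ℤ)) (N : ℕ) (y : ℕ) (γ : List SV) : Set (Set (Sym2 SV)) :=
  if Shape S y γ then {ω | (↑(edgesOf γ) : Set (Sym2 SV)) ⊆ ω} ∩ Nev q S N γ y else ∅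

/-- On `{γ open}`, "all edges of `W` off `γ` are open" is "`W` is open". [folklore] -/
theorem sdiff_subset_iff_of_subset {ω : Set (Sym2 SV)} {γ W : List SV} (hγ : (↑(edgesOf γ) : Set (Sym2 SV)) ⊆ ω) :
    (↑(edgesOf W) : Set (Sym2 SV)) \ ↑(edgesOf γ) ⊆ ω ↔ (↑(edgesOf W) : Set (Sym2 SV)) ⊆ ω := by
  constructor
  · intro h e he
    by_cases heγ : e ∈ (↑(edgesOf γ) : Set (Sym2 SV))
    · exact hγ heγ
    · exact h ⟨he, heγ⟩
  · exact fun h => Set.sdiff_subset.trans h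

section Decomposition

variable {M : ℕ} {Θ : ℤ → ℤ → ℝ} {S : Set (ℤ × ℤ)} {N : ℕ}

/-- **GM14 (6.35): `{Γ = γ} = {γ open} ∩ N_γ`** (on clean configurations, with the record
height fixed): for the canonical weights of the strip, a domain with a vertex of height `0`, and
`y ≤ N`, `ω ∈ Eopt y γ ↔ Clean ω ∧ hRec ω = y ∧ optWit ω = γ`. [cite: GrimmettManolescu2014Isoradial, §6.3 (6.35)] -/
theorem mem_Eopt_iff (hS : ∃ m : ℤ, (m, (0 : ℤ)) ∈ S) {y : ℕ} (hyN : y ≤ N) (γ : List SV) (ω : Set (Sym2 SV)) :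
    ω ∈ Eopt (canonicalWeight M Θ) S N y γ ↔
      Clean (canonicalWeight M Θ) ω ∧ hRec S N ω = y ∧ optWit S N ω = γ := by
  classical
  obtain ⟨m0, hm0⟩ := hS
  have h0 : Reaches S ω 0 := reaches_zero hm0
  constructor
  · intro h
    unfold Eopt at h
    split_ifs at h with hshape
    swap; · exact absurd h (Set.notMem_empty _)
    obtain ⟨hopen, hclean, hhigh, hmin⟩ := h
    have hγ : TopWit S ω y γ := topWit_iff.2 ⟨isWalk_iff_edgesOf_subset.2 hopen, hshape⟩
    -- the record height is `y`
    have hrec : hRec S N ω = y := by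
      refine le_antisymm ?_ (le_hRec hyN hγ.reaches)
      by_contra hlt
      push Not at hlt
      have hR := reaches_hRec (N := N) h0
      obtain ⟨W, hW⟩ := exists_topWit hclean (by positivity) hR
      refine hhigh (hRec S N ω) hlt (hRec_le h0) W (topWit_iff.1 hW).2 ?_
      rw [sdiff_subset_iff_of_subset hopen]
      exact isWalk_iff_edgesOf_subset.1 hW.walk
    refine ⟨hclean, hrec, ?_⟩
    rw [hrec.symm] at hγ
    rw [optWit_eq_iff hγ]
    intro W hlt hW
    rw [hrec] at hW
    refine hmin W hlt (topWit_iff.1 hW).2 ?_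
    rw [sdiff_subset_iff_of_subset hopen]
    exact isWalk_iff_edgesOf_subset.1 hW.walk
  · rintro ⟨hclean, hrec, hopt⟩
    -- there is a top witness of the record, so `γ` is one
    have hex : ∃ W, TopWit S ω (hRec S N ω) W := exists_topWit hclean (by positivity) (reaches_hRec h0)
    obtain ⟨hwit, hmin⟩ := optWit_spec (S := S) (N := N) hex
    rw [hopt] at hwit hmin
    rw [hrec] at hwit hmin
    have hshape : Shape S y γ := (topWit_iff.1 hwit).2
    have hopen : (↑(edgesOf γ) : Set (Sym2 SV)) ⊆ ω := isWalk_iff_edgesOf_subset.1 hwit.walk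
    unfold Eopt
    rw [if_pos hshape]
    refine ⟨hopen, hclean, fun n hyn hnN W hW hsub => ?_, fun W hlt hW hsub => ?_⟩
    · rw [sdiff_subset_iff_of_subset hopen] at hsub
      have : Reaches S ω n := (topWit_iff.2 ⟨isWalk_iff_edgesOf_subset.2 hsub, hW⟩).reaches
      have := le_hRec hnN this
      omega
    · rw [sdiff_subset_iff_of_subset hopen] at hsub
      have hW' : TopWit S ω y W := topWit_iff.2 ⟨isWalk_iff_edgesOf_subset.2 hsub, hW⟩
      exact absurd (hmin W hW') (not_le.2 hlt)

/-- The events `Eopt y γ` for a top witness in hand. [folklore] -/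
theorem topWit_of_mem_Eopt {q : Sym2 SV → unitInterval} {y : ℕ} {γ : List SV} {ω : Set (Sym2 SV)}
    (h : ω ∈ Eopt q S N y γ) : TopWit S ω y γ ∧ Clean q ω := by
  classical
  unfold Eopt at h
  split_ifs at h with hshape
  · exact ⟨topWit_iff.2 ⟨isWalk_iff_edgesOf_subset.2 h.1, hshape⟩, h.2.1⟩
  · exact absurd h (Set.notMem_empty _)

/-- **The `Eopt y γ` partition the clean configurations with record `y`.** [cite: GrimmettManolescu2014Isoradial, §6.3] -/
theorem iUnion_Eopt (hS : ∃ m : ℤ, (m, (0 : ℤ)) ∈ S) {y : ℕ} (hyN : y ≤ N) :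
    ⋃ γ : List SV, Eopt (canonicalWeight M Θ) S N y γ = {ω | Clean (canonicalWeight M Θ) ω ∧ hRec S N ω = y} := by
  ext ω
  simp only [Set.mem_iUnion, mem_Eopt_iff hS hyN, Set.mem_setOf_eq]
  constructor
  · rintro ⟨γ, h1, h2, -⟩; exact ⟨h1, h2⟩
  · rintro ⟨h1, h2⟩; exact ⟨_, h1, h2, rfl⟩

/-- The events `Eopt y γ` are pairwise disjoint in `γ`. [folklore] -/
theorem disjoint_Eopt (hS : ∃ m : ℤ, (m, (0 : ℤ)) ∈ S) {y : ℕ} (hyN : y ≤ N) :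
    Pairwise fun γ γ' : List SV => Disjoint (Eopt (canonicalWeight M Θ) S N y γ) (Eopt (canonicalWeight M Θ) S N y γ') := by
  intro γ γ' hne
  rw [Set.disjoint_left]
  intro ω h h'
  rw [mem_Eopt_iff hS hyN] at h h'
  exact hne (h.2.2.symm.trans h'.2.2)

end Decomposition

/-! ### Measurability, monotonicity, dependence on coordinates -/

/-- The cylinder event "these finitely many coordinates are present" is measurable. [folklore] -/
theorem measurableSet_setOf_subset (F : Finset (Sym2 SV)) : MeasurableSet {ω : Set (Sym2 SV) | (↑F : Set (Sym2 SV)) ⊆ ω} := by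
  have h : {ω : Set (Sym2 SV) | (↑F : Set (Sym2 SV)) ⊆ ω} = ⋂ e ∈ F, {ω | e ∈ ω} := by
    ext ω; simp [Set.subset_def]
  rw [h]
  exact Finset.measurableSet_biInter F fun e _ => measurableSet_mem e

/-- The event "some coordinate of this countable set is absent" is measurable. [folklore] -/
theorem measurableSet_setOf_not_subset (T : Set (Sym2 SV)) : MeasurableSet {ω : Set (Sym2 SV) | ¬ (T ⊆ ω)} := by
  have h : {ω : Set (Sym2 SV) | ¬ (T ⊆ ω)} = ⋃ e ∈ T, {ω | e ∈ ω}ᶜ := by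
    ext ω; simp [Set.subset_def]
  rw [h]
  exact MeasurableSet.biUnion (Set.to_countable T) fun e _ => (measurableSet_mem e).compl

/-- `N_γ` is measurable. [folklore] -/
theorem measurableSet_Nev (q : Sym2 SV → unitInterval) (S : Set (ℤ × ℤ)) (N : ℕ) (γ : List SV) (y : ℕ) :
    MeasurableSet (Nev q S N γ y) := by
  classical
  have h : Nev q S N γ y = {ω | Clean q ω} ∩
      ((⋂ n : ℕ, ⋂ (_ : y < n), ⋂ (_ : n ≤ N), ⋂ W : List SV, ⋂ (_ : Shape S n W),
          {ω : Set (Sym2 SV) | ¬ ((↑(edgesOf W) : Set (Sym2 SV)) \ ↑(edgesOf γ) ⊆ ω)}) ∩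
        ⋂ W : List SV, ⋂ (_ : Encodable.encode W < Encodable.encode γ), ⋂ (_ : Shape S y W),
          {ω : Set (Sym2 SV) | ¬ ((↑(edgesOf W) : Set (Sym2 SV)) \ ↑(edgesOf γ) ⊆ ω)}) := by
    ext ω; simp only [Nev, Set.mem_setOf_eq, Set.mem_inter_iff, Set.mem_iInter]
  rw [h]
  refine (measurableSet_setOf_clean q).inter (MeasurableSet.inter ?_ ?_)
  · exact MeasurableSet.iInter fun n => MeasurableSet.iInter fun _ => MeasurableSet.iInter fun _ =>
      MeasurableSet.iInter fun W => MeasurableSet.iInter fun _ => measurableSet_setOf_not_subset _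
  · exact MeasurableSet.iInter fun W => MeasurableSet.iInter fun _ => MeasurableSet.iInter fun _ =>
      measurableSet_setOf_not_subset _

/-- `Eopt y γ` is measurable. [folklore] -/
theorem measurableSet_Eopt (q : Sym2 SV → unitInterval) (S : Set (ℤ × ℤ)) (N : ℕ) (y : ℕ) (γ : List SV) :
    MeasurableSet (Eopt q S N y γ) := by
  classical
  unfold Eopt
  split_ifs
  · exact (measurableSet_setOf_subset _).inter (measurableSet_Nev q S N γ y)
  · exact MeasurableSet.empty

/-- **`N_γ` is a decreasing event.** [cite: GrimmettManolescu2014Isoradial, §6.3] -/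
theorem isLowerSet_Nev (q : Sym2 SV → unitInterval) (S : Set (ℤ × ℤ)) (N : ℕ) (γ : List SV) (y : ℕ) :
    IsLowerSet (Nev q S N γ y) := by
  intro ω ω' hle h
  refine ⟨fun e he => h.1 e (hle he), fun n hyn hnN W hW hsub => h.2.1 n hyn hnN W hW (hsub.trans hle),
    fun W hlt hW hsub => h.2.2 W hlt hW (hsub.trans hle)⟩

/-- The event "this coordinate is absent" is decreasing. [folklore] -/
theorem isLowerSet_setOf_notMem (e : Sym2 SV) : IsLowerSet {ω : Set (Sym2 SV) | e ∉ ω} :=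
  fun _ _ hle h he => h (hle he)

/-- **`N_γ` is determined by the coordinates off `γ`** ("`N_γ` is independent of the event
`{γ is open}`"), provided the edges of `γ` have positive weight (the cleanliness clause only
constrains coordinates of weight zero). [cite: GrimmettManolescu2014Isoradial, §6.3] -/
theorem determinedBy_Nev (q : Sym2 SV → unitInterval) (S : Set (ℤ × ℤ)) (N : ℕ) {γ : List SV} (y : ℕ)
    (hpos : ∀ e ∈ edgesOf γ, 0 < (q e : ℝ)) : DeterminedBy (Nev q S N γ y) (↑(edgesOf γ) : Set (Sym2 SV))ᶜ := by
  rw [determinedBy_iff]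
  intro ω ω' hωω'
  -- membership of coordinates off `γ` agrees
  have hagree : ∀ e, e ∉ (↑(edgesOf γ) : Set (Sym2 SV)) → (e ∈ ω ↔ e ∈ ω') := fun e he => by
    have := Set.ext_iff.1 hωω' e
    simp only [Set.mem_inter_iff, Set.mem_compl_iff] at this
    constructor
    · intro h; exact ((this.1 ⟨h, he⟩)).1
    · intro h; exact ((this.2 ⟨h, he⟩)).1
  have hsub : ∀ W : List SV, ((↑(edgesOf W) : Set (Sym2 SV)) \ ↑(edgesOf γ) ⊆ ω) ↔
      ((↑(edgesOf W) : Set (Sym2 SV)) \ ↑(edgesOf γ) ⊆ ω') := fun W =>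
    ⟨fun h e he => (hagree e he.2).1 (h he), fun h e he => (hagree e he.2).2 (h he)⟩
  have hclean : Clean q ω ↔ Clean q ω' := by
    constructor
    · intro h e he
      by_contra hq
      have heγ : e ∉ (↑(edgesOf γ) : Set (Sym2 SV)) := fun h' => hq (hpos e h')
      exact hq (h e ((hagree e heγ).2 he))
    · intro h e he
      by_contra hq
      have heγ : e ∉ (↑(edgesOf γ) : Set (Sym2 SV)) := fun h' => hq (hpos e h')
      exact hq (h e ((hagree e heγ).1 he))
  simp only [Nev, Set.mem_setOf_eq, hclean, hsub]

/-- The cylinder event of `γ` is determined by the edges of `γ`. [folklore] -/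
theorem determinedBy_setOf_subset (F : Finset (Sym2 SV)) :
    DeterminedBy {ω : Set (Sym2 SV) | (↑F : Set (Sym2 SV)) ⊆ ω} (↑F : Set (Sym2 SV)) := by
  rw [determinedBy_iff]
  intro ω ω' h
  simp only [Set.mem_setOf_eq]
  constructor
  · intro hF e he
    have := Set.ext_iff.1 h e
    simp only [Set.mem_inter_iff] at this
    exact (this.1 ⟨hF he, he⟩).1
  · intro hF e he
    have := Set.ext_iff.1 h e
    simp only [Set.mem_inter_iff] at this
    exact (this.2 ⟨hF he, he⟩).1

/-- "This coordinate is absent" is determined off `γ` when the coordinate is not an edge of `γ`. [folklore] -/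
theorem determinedBy_setOf_notMem {γ : List SV} {e : Sym2 SV} (he : e ∉ edgesOf γ) :
    DeterminedBy {ω : Set (Sym2 SV) | e ∉ ω} (↑(edgesOf γ) : Set (Sym2 SV))ᶜ := by
  rw [determinedBy_iff]
  intro ω ω' h
  have := Set.ext_iff.1 h e
  simp only [Set.mem_inter_iff, Set.mem_compl_iff, Finset.mem_coe, he, not_false_eq_true, and_true] at this
  simp only [Set.mem_setOf_eq, this]

/-! ### Closed edges beside the optimal witness: GM14 (6.36) -/

/-- **GM14 (6.36) for one edge**: for the canonical product measure of the strip, a walk `γ` and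
an edge `e` not used by `γ`,
`(1 - p_e) · P(Eopt y γ) ≤ P({e closed} ∩ Eopt y γ)` — i.e. `P(e closed | Γ = γ) ≥ 1 - p_e`:
"`P(C_F | Γ = γ) ≥ P^k_j(C_F)`", by Harris' inequality for the decreasing events `C_F`, `N_γ` and
the independence of `{γ open}` from events determined off `γ`.
[cite: GrimmettManolescu2014Isoradial, §6.3 (6.36)] -/
theorem le_real_notMem_inter_Eopt (M : ℕ) (Θ : ℤ → ℤ → ℝ) (S : Set (ℤ × ℤ)) (N : ℕ) (y : ℕ) (γ : List SV)
    {e : Sym2 SV} (he : e ∉ edgesOf γ) :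
    (1 - (canonicalWeight M Θ e : ℝ)) * (prodBernoulli (canonicalWeight M Θ)).real (Eopt (canonicalWeight M Θ) S N y γ) ≤
      (prodBernoulli (canonicalWeight M Θ)).real ({ω | e ∉ ω} ∩ Eopt (canonicalWeight M Θ) S N y γ) := by
  classical
  set q := canonicalWeight M Θ with hq
  set μ := prodBernoulli q with hμ
  by_cases hshape : Shape S y γ
  swap
  · have : Eopt q S N y γ = ∅ := by unfold Eopt; rw [if_neg hshape]
    rw [this, Set.inter_empty, measureReal_empty, mul_zero]
  -- if some edge of `γ` has weight zero, both sides vanish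
  by_cases hpos : ∀ e' ∈ edgesOf γ, 0 < (q e' : ℝ)
  swap
  · push Not at hpos
    obtain ⟨e', he', hq'⟩ := hpos
    have hempty : Eopt q S N y γ = ∅ := by
      unfold Eopt; rw [if_pos hshape]
      ext ω
      simp only [Set.mem_inter_iff, Set.mem_setOf_eq, Set.mem_empty_iff_false, iff_false, not_and]
      intro hopen hN
      exact absurd (hN.1 e' (hopen he')) (not_lt.2 hq')
    rw [hempty, Set.inter_empty, measureReal_empty, mul_zero]
  -- the decomposition `{γ open} ∩ N_γ`
  have hE : Eopt q S N y γ = {ω | (↑(edgesOf γ) : Set (Sym2 SV)) ⊆ ω} ∩ Nev q S N γ y := by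
    unfold Eopt; rw [if_pos hshape]
  set A := {ω : Set (Sym2 SV) | (↑(edgesOf γ) : Set (Sym2 SV)) ⊆ ω} with hA
  set B := Nev q S N γ y with hB
  set C := {ω : Set (Sym2 SV) | e ∉ ω} with hC
  have hAm : MeasurableSet A := measurableSet_setOf_subset _
  have hBm : MeasurableSet B := measurableSet_Nev q S N γ y
  have hCm : MeasurableSet C := (measurableSet_mem e).compl
  have hAd : DeterminedBy A (↑(edgesOf γ) : Set (Sym2 SV)) := determinedBy_setOf_subset _
  have hBd : DeterminedBy B (↑(edgesOf γ) : Set (Sym2 SV))ᶜ := determinedBy_Nev q S N y hpos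
  have hCd : DeterminedBy C (↑(edgesOf γ) : Set (Sym2 SV))ᶜ := determinedBy_setOf_notMem he
  -- independence of `{γ open}` from `N_γ` and from `C ∩ N_γ`
  have h1 : μ.real (A ∩ B) = μ.real A * μ.real B := prodBernoulli_real_inter_of_determinedBy q _ hAd hBd hAm hBm
  have h2 : μ.real (A ∩ (C ∩ B)) = μ.real A * μ.real (C ∩ B) :=
    prodBernoulli_real_inter_of_determinedBy q _ hAd (hCd.inter hBd) hAm (hCm.inter hBm)
  -- Harris for the decreasing events `C`, `N_γ`
  have h3 : μ.real C * μ.real B ≤ μ.real (C ∩ B) :=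
    prodBernoulli_harris_lower q (isLowerSet_setOf_notMem e) (isLowerSet_Nev q S N γ y) hCm hBm
  have hCval : μ.real C = 1 - (q e : ℝ) := prodBernoulli_real_setOf_notMem q e
  have hset : C ∩ Eopt q S N y γ = A ∩ (C ∩ B) := by
    rw [hE]; ext ω; simp only [Set.mem_inter_iff]; tauto
  rw [hset, h2, hE, h1, ← hCval]
  have hA0 : 0 ≤ μ.real A := measureReal_nonneg
  nlinarith

/-- **GM14 (6.36), measure form**: `ENNReal.ofReal (1 - p_e) * P(Eopt y γ) ≤ P({e closed} ∩ Eopt y γ)`.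
[cite: GrimmettManolescu2014Isoradial, §6.3 (6.36)] -/
theorem le_measure_notMem_inter_Eopt (M : ℕ) (Θ : ℤ → ℤ → ℝ) (S : Set (ℤ × ℤ)) (N : ℕ) (y : ℕ) (γ : List SV)
    {e : Sym2 SV} (he : e ∉ edgesOf γ) :
    ENNReal.ofReal (1 - (canonicalWeight M Θ e : ℝ)) * prodBernoulli (canonicalWeight M Θ) (Eopt (canonicalWeight M Θ) S N y γ) ≤
      prodBernoulli (canonicalWeight M Θ) ({ω | e ∉ ω} ∩ Eopt (canonicalWeight M Θ) S N y γ) := by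
  have h := le_real_notMem_inter_Eopt M Θ S N y γ he
  have h1 : 0 ≤ 1 - (canonicalWeight M Θ e : ℝ) := by linarith [(canonicalWeight M Θ e).2.2]
  rw [← ENNReal.ofReal_toReal (measure_ne_top _ (Eopt (canonicalWeight M Θ) S N y γ)),
    ← ENNReal.ofReal_toReal (measure_ne_top _ ({ω | e ∉ ω} ∩ Eopt (canonicalWeight M Θ) S N y γ)),
    ← ENNReal.ofReal_mul h1]
  exact ENNReal.ofReal_le_ofReal h

/-! ### Measurability of the record height -/

/-- The event "height `y` is reached within `S`" is measurable. [folklore] -/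
theorem measurableSet_setOf_reaches (S : Set (ℤ × ℤ)) (y : ℤ) : MeasurableSet {ω : Set (Sym2 SV) | Reaches S ω y} := by
  have h : {ω : Set (Sym2 SV) | Reaches S ω y} = ⋃ W : List SV, ⋃ (_ : InDom S W ∧
      (∃ a : ℤ × ℤ, W.head? = some (some a) ∧ a.2 = 0) ∧ ∃ b : ℤ × ℤ, W.getLast? = some (some b) ∧ b.2 = y),
      {ω | (↑(edgesOf W) : Set (Sym2 SV)) ⊆ ω} := by
    ext ω
    simp only [Reaches, Set.mem_setOf_eq, Set.mem_iUnion, exists_prop, isWalk_iff_edgesOf_subset]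
    constructor
    · rintro ⟨W, h1, h2, h3, h4⟩; exact ⟨W, ⟨h2, h3, h4⟩, h1⟩
    · rintro ⟨W, ⟨h2, h3, h4⟩, h1⟩; exact ⟨W, h1, h2, h3, h4⟩
  rw [h]
  exact MeasurableSet.iUnion fun W => MeasurableSet.iUnion fun _ => measurableSet_setOf_subset _

/-- **The record height is a measurable function of the configuration.** [folklore] -/
theorem measurable_hRec (S : Set (ℤ × ℤ)) (N : ℕ) : Measurable (hRec S N) := by
  classical
  -- `hRec` factors through the finitely many predicates `Reaches S ω n`, `n ≤ N`
  set R : Set (Sym2 SV) → (Fin (N + 1) → Prop) := fun ω n => Reaches S ω n with hR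
  set φ : (Fin (N + 1) → Prop) → ℕ := fun P => sSup {n : ℕ | ∃ h : n ≤ N, P ⟨n, Nat.lt_succ_of_le h⟩} with hφ
  have hfac : hRec S N = φ ∘ R := by
    funext ω
    simp only [hφ, hR, Function.comp_apply, hRec]
    congr 1
    ext n
    simp only [Set.mem_setOf_eq]
    constructor
    · rintro ⟨h1, h2⟩; exact ⟨h1, h2⟩
    · rintro ⟨h1, h2⟩; exact ⟨h1, h2⟩
  rw [hfac]
  refine (measurable_of_countable φ).comp ?_
  refine measurable_pi_lambda _ fun n => ?_
  refine measurable_to_prop ?_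
  have : R ⁻¹' {fun _ => True} = R ⁻¹' {fun _ => True} := rfl
  show MeasurableSet ((fun ω => Reaches S ω n) ⁻¹' {True})
  have h2 : (fun ω : Set (Sym2 SV) => Reaches S ω n) ⁻¹' {True} = {ω | Reaches S ω n} := by
    ext ω; simp
  rw [h2]
  exact measurableSet_setOf_reaches S n

/-- The event `{hRec = y}` is measurable. [folklore] -/
theorem measurableSet_hRec_eq (S : Set (ℤ × ℤ)) (N y : ℕ) : MeasurableSet {ω : Set (Sym2 SV) | hRec S N ω = y} :=
  measurable_hRec S N (measurableSet_singleton y)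

end TrackExchange

end Literature.Probability.Percolation
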